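import Mathlib
import Summits.NavierStokesRegularity.FluidComputer.AbcClassIIOrbits

/-!
# Class-I layer of the ABC certificate chains: DEFINITIONS
(profile-cert-3 g9 — F5 implementation-3 seat, cell `ns-blowup`, 2026-08-27; the class-I twin of instab4 g6's
`AbcClassIIDefs`, written literally parallel to it so that the two files can be diffed)

HONEST FRAMING (human rulings D-0035/D-0074): nothing here is a claim about Navier–Stokes blow-up.
WHAT THIS IS NOT: not NS evidence. MODEL lane — vocabulary only (NS linearised about the forced ABC flow
`abcFlow 1 1 1`, symmetry CLASS I). No theorem beyond the closure proofs the `Submodule` structure needs.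

WHY. The certificates of record of the `ns-blowup` profile programme for the forced ABC flow come in two
symmetry classes of the 24-element symmetry group `Γ = ⟨r, s⟩ ≅ O` of `abcFlow 1 1 1`: CLASS II (sign
character, `ρ_r c = c`, `ρ_s c = −c`; rows T0/T1/T3 — real unstable eigenvalues) and CLASS I (trivial
character, `ρ_r c = c`, `ρ_s c = +c`; rows T2 (`R = 300`) / T4 (`R = 500`) — the Hopf pairs
`λ ≈ 0.264 ± 0.643 i`, transcripts `CertificateAbcSpectrum*.Row3001*` / `Row5001*`). The class-II kernel chain
(`AbcClassII*`, `AbcClassIIEigenpair*`: a 3-B-nested certificate row about the section matrices of `L_R|II`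
in ANY admissible orbit basis ⇒ a certified eigenvalue of the tree's linearised operator,
`Torus.IsLinNSEigenvalue`) is built on `AbcClassIIDefs`; every object there is character-free EXCEPT the
class predicate and what is defined from it (the real orbit spaces, their dimensions and bases, the index
type, the basis families, the section index sets, the first-order matrix). This file supplies exactly those
for CLASS I, in the namespace `…FluidComputer.AbcClassI` with the SAME short names, and REUSES every
character-free object of `AbcClassIIDefs` / `AbcClassIIOrbits` by name (`AbcClassII.Fam`, `crossForm`, `rotR`,
`rotS`, `sgnOrbit`, `cube`, `extend`, `restrictTo`, `Orbit`, `toOrbit`, `onormSq`, `osupNorm`, `cubeOrbits`,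
`nbrOrbits`), so that the sequel files are the class-II files with the namespace changed:

* §1 SYMMETRY CLASS I `IsClassI c := rotR c = c ∧ rotS c = c` (trivial character; instab3
  `AbcLatticeSymmetry.linOp_abcFlow_class_invariant` with `χ = 1` gives its invariance under the
  linearised operator — sequel `AbcClassISymmetry`), closed under `+`, complex scalars, `0`.
* §2 The REAL class-I space `realSpace S` on a finite frequency set `S`: vectors of `ℂ^{S × 3}` whose family
  is transversal, class I and conjugate-symmetric (a real subspace; a finite-dimensional real inner product
  space with `⟪x, y⟫_ℝ = Re ⟪x, y⟫_ℂ`).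
* §3 Per orbit `O` (`AbcClassII.Orbit`, character-free): the dimension `odim O = finrank_ℝ (realSpace O)`, an
  (arbitrary, `stdOrthonormalBasis`) real orthonormal basis `orbitBasis O`, the index type
  `Idx = Σ O, Fin (odim O)` (an `abbrev`, so that `DecidableEq` is found by unfolding — no instance is
  declared), the basis families `bfam i : ℤ³ → ℂ³`, the Galerkin SECTION index sets `cubeIdx n` and the BAND
  index sets `nbrIdx i` (the character-free `cubeOrbits` / `nbrOrbits` of `AbcClassIIDefs` with class-I fibres).
* §4 The real first-order matrix `amat i j = Re Σ_k ⟪bfam i k, Π_k X(bfam j)(k)⟫` in that basis.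

Mathlib + `AbcClassIIOrbits` (transitively `AbcClassIIDefs`, `AbcLatticeReality`) only; no instances, no
notation. bears_on LADDER-NS N5 / Z4-a(1) (CR rows T2/T4) → N1 linear core.
-/

noncomputable section

open scoped BigOperators ComplexConjugate InnerProductSpace
open Finset

namespace Summit.NavierStokesRegularity.FluidComputer.AbcClassI

open Literature.Analysis.FunctionSpaces Literature.Analysis.FunctionSpaces.Torus
open Literature.Analysis.FunctionSpaces.EuclideanSpace
open Literature.Analysis.FluidPDE Literature.Analysis.FluidPDE.SteadyLattice
open Summit.NavierStokesRegularity.FluidComputer.AbcClassII (Fam crossForm rotR rotS rotR_add rotR_smul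
  rotS_add rotS_smul extend extend_add extend_smul extend_zero Orbit cubeOrbits nbrOrbits)

/-! ### §1 Symmetry class I -/

/-- **Symmetry class I** (the trivial character of the 24-element group `Γ ≅ O` of the ABC flow
`A = B = C`, INSTAB3-METHOD §1 «I (trivial)»): `ρ_r c = c` and `ρ_s c = c`, with the two generators
`rotR`, `rotS` of `AbcClassIIDefs` §2 (the class-II condition there is `ρ_s c = −c`). -/
def IsClassI (c : Fam) : Prop := rotR c = c ∧ rotS c = c

/-- Class I is a complex-linear condition: closed under addition. -/
theorem IsClassI.add {c d : Fam} (hc : IsClassI c) (hd : IsClassI d) : IsClassI (c + d) := by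
  refine ⟨?_, ?_⟩
  · rw [rotR_add, hc.1, hd.1]
  · rw [rotS_add, hc.2, hd.2]

/-- Class I is closed under complex scalars. -/
theorem IsClassI.smul {c : Fam} (hc : IsClassI c) (a : ℂ) : IsClassI (a • c) := by
  refine ⟨?_, ?_⟩
  · rw [rotR_smul, hc.1]
  · rw [rotS_smul, hc.2]

/-- The zero family is class I. -/
theorem isClassI_zero : IsClassI (0 : Fam) :=
  ⟨AbcClassII.isClassII_zero.1, by
    have h := AbcClassII.isClassII_zero.2
    rw [neg_zero] at h
    exact h⟩

/-! ### §2 The real class-I space on a finite frequency set -/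

/-- **The real class-I space on a finite frequency set `S`**: vectors `x ∈ ℂ^{S × 3}` whose family
`extend S x` is transversal (`k · c(k) = 0` for all `k`), class I, and conjugate-symmetric
(`c(−k) = conj c(k)`, `Torus.IsConjSymm`) — a REAL subspace of the complex Euclidean space (literally
`AbcClassII.realSpace` with `IsClassII` replaced by `IsClassI`). For `S` an orbit these are the real
class-I Galerkin spaces of the certifiers. -/
def realSpace (S : Finset (Fin 3 → ℤ)) : Submodule ℝ (EuclideanSpace ℂ (↥S × Fin 3)) where
  carrier := {x | (∀ k : Fin 3 → ℤ, ∑ j : Fin 3, ((k j : ℤ) : ℂ) * extend S x k j = 0) ∧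
    IsClassI (extend S x) ∧ Torus.IsConjSymm (extend S x)}
  add_mem' := by
    rintro x y ⟨hxt, hxc, hxj⟩ ⟨hyt, hyc, hyj⟩
    refine ⟨fun k => ?_, ?_, ?_⟩
    · rw [extend_add]
      have h : ∑ j : Fin 3, ((k j : ℤ) : ℂ) * (extend S x + extend S y) k j =
          ∑ j : Fin 3, ((k j : ℤ) : ℂ) * extend S x k j + ∑ j : Fin 3, ((k j : ℤ) : ℂ) * extend S y k j := by
        rw [← Finset.sum_add_distrib]
        refine Finset.sum_congr rfl fun j _ => ?_
        simp only [Pi.add_apply, PiLp.add_apply, mul_add]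
      rw [h, hxt k, hyt k, add_zero]
    · rw [extend_add]; exact hxc.add hyc
    · rw [extend_add]; exact hxj.add hyj
  zero_mem' := by
    refine ⟨fun k => ?_, ?_, ?_⟩
    · rw [extend_zero]; simp
    · rw [extend_zero]; exact isClassI_zero
    · rw [extend_zero]; exact Torus.isConjSymm_zero
  smul_mem' := by
    rintro a x ⟨hxt, hxc, hxj⟩
    have ha : (a • x : EuclideanSpace ℂ (↥S × Fin 3)) = ((a : ℂ) • x) := rfl
    refine ⟨fun k => ?_, ?_, ?_⟩
    · rw [ha, extend_smul]
      have h : ∑ j : Fin 3, ((k j : ℤ) : ℂ) * ((a : ℂ) • extend S x) k j =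
          (a : ℂ) * ∑ j : Fin 3, ((k j : ℤ) : ℂ) * extend S x k j := by
        rw [Finset.mul_sum]
        refine Finset.sum_congr rfl fun j _ => ?_
        simp only [Pi.smul_apply, PiLp.smul_apply, smul_eq_mul]
        ring
      rw [h, hxt k, mul_zero]
    · rw [ha, extend_smul]; exact hxc.smul _
    · rw [ha, extend_smul]
      intro k
      rw [Pi.smul_apply, Pi.smul_apply, hxj k, conjVec_smul, Complex.conj_ofReal]

/-! ### §3 The orbit-adapted real orthonormal basis, the index type, sections and band -/

/-- The real dimension `d_O` of the class-I real space on the orbit `O`. -/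
abbrev odim (O : Orbit) : ℕ := Module.finrank ℝ (realSpace O.1)

/-- **The orbit-adapted real orthonormal basis** (class I): an (arbitrary) orthonormal basis of the finite-
dimensional real inner product space `realSpace O`, indexed by `Fin (odim O)`. Only its EXISTENCE and
orthonormality are ever used; no formula for it is claimed. -/
def orbitBasis (O : Orbit) : OrthonormalBasis (Fin (odim O)) ℝ (realSpace O.1) :=
  stdOrthonormalBasis ℝ (realSpace O.1)

/-- **The index type of the class-I basis**: an orbit and a basis index on it (an `abbrev`: equality is
decidable by unfolding to the `Sigma` instance over `AbcClassII.Orbit` and `Fin`). -/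
abbrev Idx : Type := Σ O : Orbit, Fin (odim O)

/-- **The class-I basis families** `bfam i : ℤ³ → ℂ³`: the family (extension by zero) of the `i.2`-th vector
of the orthonormal basis of `realSpace (orbit i.1)` — supported on one orbit, transversal, class I,
conjugate-symmetric (sequel `AbcClassIBasis`). -/
def bfam (i : Idx) : Fam := extend i.1.1 ((orbitBasis i.1 i.2 : realSpace i.1.1) : EuclideanSpace ℂ _)

/-- **The Galerkin SECTION index set of level `n`** (class I): all basis indices whose orbit lies in the
sup-norm cube `n` (`AbcClassII.cubeOrbits n`, character-free, with class-I fibres). -/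
def cubeIdx (n : ℕ) : Finset Idx :=
  (cubeOrbits n).sigma fun O => (Finset.univ : Finset (Fin (odim O)))

/-- **The BAND of the first-order matrix** (class I): all basis indices on orbits meeting the six-neighbour
set of the orbit of `i` (`AbcClassII.nbrOrbits`, character-free, with class-I fibres). -/
def nbrIdx (i : Idx) : Finset Idx :=
  (nbrOrbits i.1).sigma fun O => (Finset.univ : Finset (Fin (odim O)))

/-! ### §4 The real first-order matrix -/

/-- **The real first-order matrix in the class-I orbit-adapted basis**:
`amat i j = Re Σ_{k ∈ orbit i} ⟪bfam i k, Π_k X(bfam j)(k)⟫` (`X = AbcClassII.crossForm 1 1 1`, the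
certifiers' first-order symbol; the sum is real by conjugate symmetry — sequel). The section matrix of
`x − L_R|I` on `cubeIdx n` is `(x + onormSq/R) δ_ij − amat i j`. -/
def amat (i j : Idx) : ℝ :=
  (∑ k ∈ i.1.1, (inner ℂ (bfam i k) (Torus.lerayCoeff k (crossForm 1 1 1 (bfam j) k)) : ℂ)).re

end Summit.NavierStokesRegularity.FluidComputer.AbcClassI

end
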